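import Literature.AlgebraicGeometry.HodgeTheory.AffineSpaceBundleCohomology
import HarnessLib

/-!
# Zariski-local affine-space products: base change along a morphism, isomorphisms, the trivial case

Family `hodge`, layer `Literature/AlgebraicGeometry/HodgeTheory`; companion to
`AffineSpaceBundleCohomology` (definition of `IsZariskiLocallyAffineProduct π r`: `π : W ⟶ P` is,
Zariski-locally on `P`, the projection `V × 𝔸ʳ → V`, charts being stated through open immersions)
and `JouanolouDeviceCohomology` (stability under extension of the base field). Theorem-only file
(no definitions, no named facts), recording the formal properties used to restrict Jouanolou's
affine torsor `W → ℙᴺ` (Jouanolou 1973, Lemme 1.5) to a subscheme `X ⟶ ℙᴺ`: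

* `IsZariskiLocallyAffineProduct.of_isPullback` — stability under base change along any
  `ℂ`-morphism `f : X ⟶ P` (cartesian squares in `SchemeOver ℂ`);
* `IsZariskiLocallyAffineProduct.iso_hom_comp` — invariance under isomorphisms of the source;
* `isZariskiLocallyAffineProduct_fst` — the projection `V ⊗ 𝔸ʳ ⟶ V` itself (one global chart), so
  that the notion is visibly non-vacuous.

## References

* J.-P. Jouanolou, *Une suite exacte de Mayer–Vietoris en K-théorie algébrique*, LNM 341 (1973), Lemme 1.5.
* R. Hartshorne, *Algebraic Geometry* (1977), II.3 Thm. 3.3 (base extension; fibre products).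
-/

noncomputable section

open CategoryTheory CategoryTheory.Limits AlgebraicGeometry Function Set MonoidalCategory
open Literature.NumberTheory.Transcendental
open Literature.AlgebraicGeometry.Motives

namespace Literature.AlgebraicGeometry.HodgeTheory

section HodgeTheory

/-! ### Base change along a morphism -/

/-- The image of the second projection of a cartesian square of `ℂ`-schemes is the preimage of the
image of the opposite side (the underlying square of schemes is cartesian, `Over.forget` preserving
pullbacks; Mathlib `Scheme.Pullback.range_snd`). [cite: Hartshorne1977, II.3 Thm. 3.3] -/
theorem range_snd_left_of_isPullback {A B C D : SchemeOver ℂ} {p : A ⟶ B} {q : A ⟶ C} {b : B ⟶ D}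
    {c : C ⟶ D} (sq : IsPullback p q b c) :
    Set.range q.left.base = c.left.base ⁻¹' Set.range b.left.base := by
  have H : IsPullback p.left q.left b.left c.left := sq.map (Over.forget _)
  rw [← H.isoPullback_hom_snd, Scheme.Hom.comp_base, TopCat.coe_comp, Set.range_comp,
    Set.range_eq_univ.mpr H.isoPullback.hom.surjective, Set.image_univ, Scheme.Pullback.range_snd]

/-- Open immersions of `ℂ`-schemes are stable under base change in `SchemeOver ℂ` (the underlying
square of schemes is cartesian). [cite: Hartshorne1977, II.3 Thm. 3.3] -/
theorem isOpenImmersion_snd_left_of_isPullback {A B C D : SchemeOver ℂ} {p : A ⟶ B} {q : A ⟶ C} {b : B ⟶ D}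
    {c : C ⟶ D} (sq : IsPullback p q b c) [IsOpenImmersion b.left] : IsOpenImmersion q.left :=
  MorphismProperty.of_isPullback (P := @IsOpenImmersion) (sq.map (Over.forget _)) ‹_›

/-- **Zariski-local affine-space products are stable under base change along a morphism.** If
`π : W ⟶ P` is Zariski-locally on `P` a product with `𝔸ʳ` and the square `p' ≫ π = π' ≫ f` with
`π' : W' ⟶ X`, `f : X ⟶ P` is cartesian in `SchemeOver ℂ`, then `π'` is Zariski-locally on `X` a
product with `𝔸ʳ`: a chart `(j : V ⟶ P, i : U ⟶ W, e : U ≅ V ⊗ 𝔸ʳ)` at `f(x)` pulls back to the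
chart `(V ×_P X ⟶ X, U ×_W W' ⟶ W', U ×_W W' ≅ (V ×_P X) ⊗ 𝔸ʳ)` at `x`, the last isomorphism by the
universal properties of the three fibre products involved (its two composites are checked against
the projections). This is the form in which Jouanolou's torsor over `ℙᴺ` restricts to a closed
(or any) `X ⟶ ℙᴺ`. [cite: Jouanolou1973, Lemme 1.5] [cite: Hartshorne1977, II.3 Thm. 3.3] -/
theorem IsZariskiLocallyAffineProduct.of_isPullback {W P W' X : SchemeOver ℂ} {π : W ⟶ P}
    {f : X ⟶ P} {p' : W' ⟶ W} {π' : W' ⟶ X} (sq : IsPullback p' π' π f) {r : ℕ}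
    (h : IsZariskiLocallyAffineProduct π r) : IsZariskiLocallyAffineProduct π' r := by
  intro x
  obtain ⟨V, U, j, i, hj, hi, e, hx, hsub, hsq⟩ := h (f.left.base x)
  -- the base-changed charts
  let V' : SchemeOver ℂ := pullback j f
  let j' : V' ⟶ X := pullback.snd j f
  let U' : SchemeOver ℂ := pullback i p'
  let i' : U' ⟶ W' := pullback.snd i p'
  have sqV : IsPullback (pullback.fst j f) j' j f := IsPullback.of_hasPullback j f
  have sqU : IsPullback (pullback.fst i p') i' i p' := IsPullback.of_hasPullback i p'
  haveI : IsOpenImmersion j'.left := isOpenImmersion_snd_left_of_isPullback sqV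
  haveI : IsOpenImmersion i'.left := isOpenImmersion_snd_left_of_isPullback sqU
  -- useful identities
  have hinv : e.inv ≫ i ≫ π = CartesianMonoidalCategory.fst _ _ ≫ j := by
    rw [Iso.inv_comp_eq, hsq]
  -- forward map `U' ⟶ V' ⊗ 𝔸`
  have hcompat₁ : (pullback.fst i p' ≫ e.hom ≫ CartesianMonoidalCategory.fst _ _) ≫ j = (i' ≫ π') ≫ f := by
    simp only [Category.assoc]
    rw [hsq, ← Category.assoc, pullback.condition, Category.assoc, sq.w]
  let toV' : U' ⟶ V' := pullback.lift (pullback.fst i p' ≫ e.hom ≫ CartesianMonoidalCategory.fst _ _) (i' ≫ π') hcompat₁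
  let φ : U' ⟶ V' ⊗ affineSpaceOver (Fin r) ℂ :=
    CartesianMonoidalCategory.lift toV' (pullback.fst i p' ≫ e.hom ≫ CartesianMonoidalCategory.snd _ _)
  -- backward map `V' ⊗ 𝔸 ⟶ U'`
  let toU : V' ⊗ affineSpaceOver (Fin r) ℂ ⟶ U := (pullback.fst j f ▷ affineSpaceOver (Fin r) ℂ) ≫ e.inv
  have hcompat₂ : (toU ≫ i) ≫ π = (CartesianMonoidalCategory.fst _ _ ≫ j') ≫ f := by
    simp only [toU, Category.assoc]
    rw [hinv, CartesianMonoidalCategory.whiskerRight_fst_assoc, pullback.condition]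
  let toW' : V' ⊗ affineSpaceOver (Fin r) ℂ ⟶ W' := sq.lift (toU ≫ i) (CartesianMonoidalCategory.fst _ _ ≫ j') hcompat₂
  let ψ : V' ⊗ affineSpaceOver (Fin r) ℂ ⟶ U' :=
    pullback.lift toU toW' (by rw [sq.lift_fst])
  -- the two composites
  have hφU : φ ≫ toU = pullback.fst i p' := by
    change φ ≫ (pullback.fst j f ▷ affineSpaceOver (Fin r) ℂ) ≫ e.inv = pullback.fst i p'
    rw [← Category.assoc, Iso.comp_inv_eq]
    apply CartesianMonoidalCategory.hom_ext
    · rw [Category.assoc, CartesianMonoidalCategory.whiskerRight_fst]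
      simp only [V', U', i', φ, toV', CartesianMonoidalCategory.lift_fst_assoc, pullback.lift_fst,
        Category.assoc]
    · rw [Category.assoc, CartesianMonoidalCategory.whiskerRight_snd]
      simp only [V', U', i', φ, toV', CartesianMonoidalCategory.lift_snd, Category.assoc]
  have hφψ : φ ≫ ψ = 𝟙 U' := by
    apply pullback.hom_ext
    · simp only [ψ, Category.assoc, pullback.lift_fst, Category.id_comp, hφU]
    · simp only [ψ, Category.assoc, pullback.lift_snd, Category.id_comp]
      apply sq.hom_ext
      · simp only [toW', Category.assoc, IsPullback.lift_fst]
        rw [← Category.assoc, hφU]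
        exact pullback.condition
      · simp only [V', U', j', i', toW', φ, toV', Category.assoc, IsPullback.lift_snd,
          CartesianMonoidalCategory.lift_fst_assoc, pullback.lift_snd]
  have hψU : ψ ≫ pullback.fst i p' ≫ e.hom = pullback.fst j f ▷ affineSpaceOver (Fin r) ℂ := by
    simp only [ψ, toU, pullback.lift_fst_assoc, Category.assoc, Iso.inv_hom_id, Category.comp_id]
  have hψφ : ψ ≫ φ = 𝟙 _ := by
    apply CartesianMonoidalCategory.hom_ext
    · rw [Category.id_comp]
      have h1 : ψ ≫ φ ≫ CartesianMonoidalCategory.fst _ _ = ψ ≫ toV' := by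
        simp only [V', U', i', φ, toV', CartesianMonoidalCategory.lift_fst]
      rw [Category.assoc, h1]
      apply pullback.hom_ext
      · have h2 : toV' ≫ pullback.fst j f = pullback.fst i p' ≫ e.hom ≫ CartesianMonoidalCategory.fst _ _ := by
          simp only [V', U', i', toV', pullback.lift_fst]
        rw [Category.assoc, h2, ← Category.assoc (pullback.fst i p'), ← Category.assoc ψ, hψU,
          CartesianMonoidalCategory.whiskerRight_fst]
      · have h3 : toV' ≫ pullback.snd j f = i' ≫ π' := by
          simp only [V', U', i', toV', pullback.lift_snd]
        have h4 : ψ ≫ i' = toW' := by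
          simp only [V', U', i', ψ, pullback.lift_snd]
        rw [Category.assoc, h3, ← Category.assoc ψ, h4]
        simp only [V', j', toW', IsPullback.lift_snd]
    · rw [Category.id_comp]
      have h5 : ψ ≫ φ ≫ CartesianMonoidalCategory.snd _ _ =
          ψ ≫ pullback.fst i p' ≫ e.hom ≫ CartesianMonoidalCategory.snd _ _ := by
        simp only [V', U', φ, CartesianMonoidalCategory.lift_snd]
      rw [Category.assoc, h5, ← Category.assoc (pullback.fst i p'), ← Category.assoc ψ, hψU,
        CartesianMonoidalCategory.whiskerRight_snd]
  let e' : U' ≅ V' ⊗ affineSpaceOver (Fin r) ℂ := ⟨φ, ψ, hφψ, hψφ⟩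
  refine ⟨V', U', j', i', ‹_›, ‹_›, e', ?_, ?_, ?_⟩
  · rw [range_snd_left_of_isPullback sqV]
    exact hx
  · intro w hw
    rw [range_snd_left_of_isPullback sqU, Set.mem_preimage]
    rw [Set.mem_preimage, range_snd_left_of_isPullback sqV, Set.mem_preimage] at hw
    refine hsub ?_
    rw [Set.mem_preimage]
    have hnat : π.left.base (p'.left.base w) = f.left.base (π'.left.base w) := by
      change (p' ≫ π).left.base w = (π' ≫ f).left.base w
      rw [sq.w]
    rw [hnat]
    exact hw
  · change φ ≫ CartesianMonoidalCategory.fst _ _ ≫ j' = i' ≫ π'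
    simp only [V', U', j', i', φ, toV', CartesianMonoidalCategory.lift_fst_assoc, pullback.lift_snd]

/-! ### Isomorphic sources; the trivial bundle -/

/-- A Zariski-local affine-space product stays one after an isomorphism of the source: the square
`ε.hom ≫ π = (ε.hom ≫ π) ≫ 𝟙` is cartesian. [cite: Hartshorne1977, II.3 Thm. 3.3] -/
theorem IsZariskiLocallyAffineProduct.iso_hom_comp {W W' P : SchemeOver ℂ} (ε : W' ≅ W) {π : W ⟶ P}
    {r : ℕ} (h : IsZariskiLocallyAffineProduct π r) : IsZariskiLocallyAffineProduct (ε.hom ≫ π) r :=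
  IsZariskiLocallyAffineProduct.of_isPullback
    (IsPullback.of_horiz_isIso (show CommSq ε.hom (ε.hom ≫ π) π (𝟙 P) from ⟨by rw [Category.comp_id]⟩)) h

/-- **The trivial affine-space bundle**: the projection `V ⊗ 𝔸ʳ ⟶ V` is Zariski-locally (indeed
globally: one chart `(𝟙, 𝟙, Iso.refl)`) a product with `𝔸ʳ`. [cite: Jouanolou1973, Lemme 1.5] -/
theorem isZariskiLocallyAffineProduct_fst (V : SchemeOver ℂ) (r : ℕ) :
    IsZariskiLocallyAffineProduct
      (CartesianMonoidalCategory.fst V (affineSpaceOver (Fin r) ℂ)) r := by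
  intro x
  refine ⟨V, V ⊗ affineSpaceOver (Fin r) ℂ, 𝟙 V, 𝟙 _, ?_, ?_, Iso.refl _, ?_, ?_, ?_⟩
  · change IsOpenImmersion (𝟙 V.left)
    infer_instance
  · change IsOpenImmersion (𝟙 (V ⊗ affineSpaceOver (Fin r) ℂ).left)
    infer_instance
  · exact ⟨x, rfl⟩
  · intro w _
    exact ⟨w, rfl⟩
  · simp only [Iso.refl_hom, Category.id_comp, Category.comp_id]

end HodgeTheory

end Literature.AlgebraicGeometry.HodgeTheory

end
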